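import Literature.MathematicalPhysics.QuantumLattice.SU2HaarSmallBallUpper
import Literature.MathematicalPhysics.QuantumFieldTheory.WilsonPlaquetteWeakCouplingFloorSU2
import Literature.MathematicalPhysics.QuantumFieldTheory.StrongCouplingActivities
import Mathlib.Analysis.SpecialFunctions.Gaussian.GaussianIntegral
import Mathlib.MeasureTheory.Integral.Pi
import HarnessLib

/-!
# Crux `UVSeamRec` (stmt-QuantumFields-20043), Tier 2 of the torus thermal ceiling: the two `SU(2)` one-link inputs —
# the SHARP small ball `Haar{2 − Re tr U ≤ r²} ≥ r³/200` and the one-plaquette Laplace bound `∫ e^{−b(2 − Re tr U)} dU ≤ 3 b^{−3/2}`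

Helper file (`--supports stmt-QuantumFields-20043`) of the LEAD seat `ym-spine-20043-p1` (gen 11).  Sizing of record: tempered-d1 g5
`MEMO-D1-g5-coldwall-ceiling.md` §Tier 2 (director-ym R395): removing the `log β` from the torus thermal ceiling needs an UPPER bound on the
partition function `Z(β/2)` matching a LOWER bound on `Z(β)` to within `e^{O(#links)}`, both of order `β^{−3m/2}`; the exponent `3 = dim SU(2)` must be
SHARP on both sides.  The two one-link inputs, proved here from the tree's cone description of Haar measure on `SU(2)`
(`SU2Haar.haarProbability_su2_eq_su2BallMeasure`: Haar is the law of the radial projection `quatToSU2 x` of `x` uniform in the unit ball of `ℍ`):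

* **`le_haarProbability_su2_two_sub_trace_le_sharp`** — `Haar{U : 2 − Re tr U ≤ r²} ≥ r³/200` for `0 < r ≤ 1` (the tree's
  `le_haarProbability_su2_two_sub_trace_le` has the non-sharp order `r⁴`): the box `{1/2 < re x < 9/10, |im x|_∞ < r/5}` of volume `16r³/625` lies in
  the unit ball and projects into the set (`2 − Re tr(x/‖x‖) = 2(‖x‖ − re x)/‖x‖ ≤ 4|im x|² < 12r²/25`), and `vol(B⁴) = π²/2 < 5`;
  `haarProbability_real_frobeniusBall_ge_su2_sharp` — the Frobenius-ball reading `Haar{‖U − 1‖_F ≤ r} ≥ r³/600` (`‖U − 1‖_F² = 2(2 − Re tr U)`);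
* **`lintegral_exp_neg_mul_two_sub_trace_le`** — `∫ exp(−b(2 − Re tr U)) dHaar(U) ≤ 3/(b√b)` for `b > 0`: on the unit ball
  `2 − Re tr(x/‖x‖) ≥ |im x|²`, so the cone integral is at most `(2/π²) ∫_{|re|<1} ∫_{ℝ³} e^{−b|v|²} dv = 4 π^{−1/2} b^{−3/2}` (Gaussian integral);
  `lintegral_exp_neg_mul_two_sub_trace_conj_inv_le` — the same for `∫ exp(−b(2 − Re tr(a V⁻¹ c))) dHaar(V)` (two-sided translation and inversion
  invariance of Haar measure on the compact group), the form consumed by the one-link peeling of the partition function.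

HONEST FRAMING: two elementary `SU(2)` integrals; nothing of E0′, NT or the gap; not Clay.
-/

open MeasureTheory Quaternion Filter Topology Set
open scoped Quaternion ENNReal Matrix Matrix.Norms.Frobenius
open Literature.MathematicalPhysics.QuantumLattice
open Literature.MathematicalPhysics.QuantumFieldTheory (haarProbability sub_re_trace_eq_half_norm_sub_one_sq)

noncomputable section

namespace Summit.QuantumFields.YangMills.Cruxes.UVSeamRec.ClassicalResponse.ThermalFloor

/-! ### The sharp small ball -/

/-- **The cone over the box `{1/2 < re < 9/10, |im|_∞ < r/5}` lies in the trace-neighbourhood `{2 − Re tr ≤ r²}`** (and the box lies in the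
unit ball): for such `x`, `2 − Re tr(x/‖x‖) = 2(‖x‖ − re x)/‖x‖ ≤ 4|im x|² < r²`. [folklore] -/
theorem two_sub_trace_re_quatToSU2_le_of_box {r : ℝ} (hr1 : r ≤ 1) {x : ℍ} (hre1 : 1 / 2 < x.re) (hre2 : x.re < 9 / 10)
    (hI : |x.imI| < r / 5) (hJ : |x.imJ| < r / 5) (hK : |x.imK| < r / 5) :
    ‖x‖ < 1 ∧ 2 - (((quatToSU2 x : (Matrix.specialUnitaryGroup (Fin 2) ℂ)) : Matrix (Fin 2) (Fin 2) ℂ).trace).re ≤ r ^ 2 := by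
  have hsq := sq_norm_eq_sum_sq x
  have hr0 : 0 < r := by linarith [abs_nonneg x.imI]
  have hI2 : x.imI ^ 2 < (r / 5) ^ 2 := sq_lt_sq' (abs_lt.1 hI).1 (abs_lt.1 hI).2
  have hJ2 : x.imJ ^ 2 < (r / 5) ^ 2 := sq_lt_sq' (abs_lt.1 hJ).1 (abs_lt.1 hJ).2
  have hK2 : x.imK ^ 2 < (r / 5) ^ 2 := sq_lt_sq' (abs_lt.1 hK).1 (abs_lt.1 hK).2
  set S : ℝ := x.imI ^ 2 + x.imJ ^ 2 + x.imK ^ 2 with hS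
  have hS0 : 0 ≤ S := by positivity
  have him : S < 3 * r ^ 2 / 25 := by rw [hS]; linarith
  have hr2 : r ^ 2 ≤ 1 := by nlinarith
  have hn2 : ‖x‖ ^ 2 < 1 ^ 2 := by rw [hsq]; nlinarith
  have hn0 : 0 ≤ ‖x‖ := norm_nonneg x
  have hn1 : ‖x‖ < 1 := lt_of_pow_lt_pow_left₀ 2 zero_le_one hn2
  refine ⟨hn1, ?_⟩
  have hx : x ≠ 0 := by
    intro h; rw [h] at hre1; norm_num at hre1
  have hnpos : 0 < ‖x‖ := norm_pos_iff.2 hx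
  rw [trace_quatToSU2_re hx]
  have hre_le : x.re ≤ ‖x‖ := le_trans (le_abs_self _) (abs_re_le_norm x)
  -- `‖x‖ − re = S/(‖x‖ + re) ≤ S` as `‖x‖ + re ≥ 1`
  have hprod : (‖x‖ - x.re) * (‖x‖ + x.re) = S := by
    have : (‖x‖ - x.re) * (‖x‖ + x.re) = ‖x‖ ^ 2 - x.re ^ 2 := by ring
    rw [this, hsq, hS]; ring
  have hsum1 : 1 ≤ ‖x‖ + x.re := by linarith
  have hnre : ‖x‖ - x.re ≤ S := by
    have h0 : 0 ≤ ‖x‖ - x.re := by linarith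
    nlinarith [mul_le_mul_of_nonneg_left hsum1 h0]
  -- `S ≤ ‖x‖ r²/2` (as `S < 3r²/25` and `‖x‖ > 1/2`)
  have hSle : S ≤ ‖x‖ * (r ^ 2 / 2) := by nlinarith
  have hinv : 1 - r ^ 2 / 2 ≤ ‖x‖⁻¹ * x.re := by
    rw [le_inv_mul_iff₀ hnpos]
    nlinarith
  linarith

/-- **SHARP small-ball lower bound for `SU(2)`.**  For `0 < r ≤ 1`: `Haar{U ∈ SU(2) : 2 − Re tr U ≤ r²} ≥ r³/200` — the true order `r³ = r^{dim SU(2)}`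
(the cone over the set inside the unit quaternion ball contains the box `{1/2 < re < 9/10, |im|_∞ < r/5}` of volume `16r³/625`, and `vol(B⁴) = π²/2`).
[folklore] -/
theorem le_haarProbability_su2_two_sub_trace_le_sharp {r : ℝ} (hr : 0 < r) (hr1 : r ≤ 1) :
    ENNReal.ofReal (r ^ 3 / 200) ≤
      haarProbability (Matrix.specialUnitaryGroup (Fin 2) ℂ)
        {U : (Matrix.specialUnitaryGroup (Fin 2) ℂ) | 2 - ((U : Matrix (Fin 2) (Fin 2) ℂ).trace).re ≤ r ^ 2} := by
  letI : MeasurableSpace ℍ := Literature.Analysis.FluidPDE.Tao2016.quatMeasurableSpace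
  haveI : BorelSpace ℍ := Literature.Analysis.FluidPDE.Tao2016.quatBorelSpace
  set T : Set (Matrix.specialUnitaryGroup (Fin 2) ℂ) :=
    {U : (Matrix.specialUnitaryGroup (Fin 2) ℂ) | 2 - ((U : Matrix (Fin 2) (Fin 2) ℂ).trace).re ≤ r ^ 2} with hT
  have hTm : MeasurableSet T := by
    refine (isClosed_le ?_ continuous_const).measurableSet
    exact continuous_const.sub (Complex.continuous_re.comp (continuous_subtype_val.matrix_trace))
  -- the box in the coordinates `ℍ ≃ ℝ × ℝ³`
  set Box : Set (ℝ × (Fin 3 → ℝ)) := Set.Ioo (1 / 2 : ℝ) (9 / 10) ×ˢ Metric.ball (0 : Fin 3 → ℝ) (r / 5) with hBox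
  have hBoxm : MeasurableSet Box := measurableSet_Ioo.prod Metric.isOpen_ball.measurableSet
  have hsub : quatReImEquiv ⁻¹' Box ⊆ quatToSU2 ⁻¹' T ∩ Metric.ball 0 1 := by
    intro x hx
    rw [Set.mem_preimage, quatReImEquiv_apply, hBox, Set.mem_prod, Set.mem_Ioo, Metric.mem_ball, dist_zero_right,
      pi_norm_lt_iff (by positivity)] at hx
    obtain ⟨⟨hre1, hre2⟩, him⟩ := hx
    have hI : |x.imI| < r / 5 := by simpa using him 0
    have hJ : |x.imJ| < r / 5 := by simpa using him 1
    have hK : |x.imK| < r / 5 := by simpa using him 2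
    obtain ⟨hn1, hle⟩ := two_sub_trace_re_quatToSU2_le_of_box hr1 hre1 hre2 hI hJ hK
    exact ⟨hle, by rwa [Metric.mem_ball, dist_zero_right]⟩
  have hvolBox : (volume : Measure (ℝ × (Fin 3 → ℝ))) Box = ENNReal.ofReal (16 * r ^ 3 / 625) := by
    rw [hBox, Measure.volume_eq_prod, Measure.prod_prod, Real.volume_Ioo, Real.volume_pi_ball _ (by positivity),
      Fintype.card_fin, ← ENNReal.ofReal_mul (by norm_num)]
    congr 1
    ring
  have hpre : (volume : Measure ℍ) (quatReImEquiv ⁻¹' Box) = ENNReal.ofReal (16 * r ^ 3 / 625) := by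
    rw [measurePreserving_quatReImEquiv.measure_preimage hBoxm.nullMeasurableSet, hvolBox]
  rw [haarProbability_su2_eq_su2BallMeasure, su2BallMeasure, Measure.smul_apply,
    Measure.map_apply measurable_quatToSU2 hTm, Measure.restrict_apply (measurable_quatToSU2 hTm), smul_eq_mul]
  calc ENNReal.ofReal (r ^ 3 / 200)
      ≤ ENNReal.ofReal (16 * r ^ 3 / 625 / (Real.pi ^ 2 / 2)) := by
        refine ENNReal.ofReal_le_ofReal ?_
        rw [le_div_iff₀ (by positivity)]
        have hπ : Real.pi < 3.15 := Real.pi_lt_d2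
        have hπ0 : 0 < Real.pi := Real.pi_pos
        have h10 : Real.pi ^ 2 < 10 := by nlinarith
        nlinarith [pow_pos hr 3]
    _ = ((volume : Measure ℍ) (Metric.ball 0 1))⁻¹ * (volume : Measure ℍ) (quatReImEquiv ⁻¹' Box) := by
        rw [hpre, volume_ball_quat,
          show ENNReal.ofReal (16 * r ^ 3 / 625 / (Real.pi ^ 2 / 2)) =
              ENNReal.ofReal (16 * r ^ 3 / 625) / ENNReal.ofReal (Real.pi ^ 2 / 2) from
            ENNReal.ofReal_div_of_pos (by positivity),
          ENNReal.div_eq_inv_mul]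
    _ ≤ ((volume : Measure ℍ) (Metric.ball 0 1))⁻¹ * (volume : Measure ℍ) (quatToSU2 ⁻¹' T ∩ Metric.ball 0 1) :=
        mul_le_mul_right (measure_mono hsub) _

/-- **Frobenius-ball reading**: `Haar{U ∈ SU(2) : ‖U − 1‖_F ≤ r} ≥ r³/600` for `0 < r ≤ 1` (`‖U − 1‖_F² = 2(2 − Re tr U)`, so the ball contains the
trace-neighbourhood `{2 − Re tr U ≤ (r/√2)²}`, and `(r/√2)³/200 ≥ r³/600`). [folklore] -/
theorem haarProbability_real_frobeniusBall_ge_su2_sharp {r : ℝ} (hr : 0 < r) (hr1 : r ≤ 1) :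
    r ^ 3 / 600 ≤ (haarProbability (Matrix.specialUnitaryGroup (Fin 2) ℂ)).real
      {U : Matrix.specialUnitaryGroup (Fin 2) ℂ | ‖fundamentalRep (Fin 2) U - 1‖ ≤ r} := by
  set s : ℝ := r / Real.sqrt 2 with hs
  have hsqrt2 : 0 < Real.sqrt 2 := Real.sqrt_pos.2 (by norm_num)
  have hs0 : 0 < s := by positivity
  have hsq2 : Real.sqrt 2 ^ 2 = 2 := Real.sq_sqrt (by norm_num)
  have hs2 : s ^ 2 = r ^ 2 / 2 := by rw [hs, div_pow, hsq2]
  have hs1 : s ≤ 1 := by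
    rw [hs, div_le_one hsqrt2]
    have : (1 : ℝ) ≤ Real.sqrt 2 := by
      rw [show (1 : ℝ) = Real.sqrt 1 by simp]; exact Real.sqrt_le_sqrt (by norm_num)
    linarith
  have hsub : {U : Matrix.specialUnitaryGroup (Fin 2) ℂ | 2 - ((U : Matrix (Fin 2) (Fin 2) ℂ).trace).re ≤ s ^ 2} ⊆
      {U : Matrix.specialUnitaryGroup (Fin 2) ℂ | ‖fundamentalRep (Fin 2) U - 1‖ ≤ r} := by
    intro U hU
    have hU' : (2 : ℝ) - ((U : Matrix (Fin 2) (Fin 2) ℂ).trace).re ≤ s ^ 2 := hU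
    have hid := sub_re_trace_eq_half_norm_sub_one_sq (fundamentalRep_mem_unitaryGroup U)
    rw [fundamentalRep_apply] at hid
    have hsq : ‖(U : Matrix (Fin 2) (Fin 2) ℂ) - 1‖ ^ 2 ≤ r ^ 2 := by
      have : ((2 : ℕ) : ℝ) = 2 := by norm_num
      rw [this] at hid
      rw [hs2] at hU'
      linarith
    show ‖fundamentalRep (Fin 2) U - 1‖ ≤ r
    rw [fundamentalRep_apply]
    exact (pow_le_pow_iff_left₀ (norm_nonneg _) hr.le two_ne_zero).1 hsq
  have h := le_haarProbability_su2_two_sub_trace_le_sharp hs0 hs1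
  -- `s³/200 ≥ r³/600`: `s³ = r³/(2√2) ≥ r³/3`
  have hs3 : r ^ 3 / 600 ≤ s ^ 3 / 200 := by
    have hcube : s ^ 3 = r ^ 3 / (2 * Real.sqrt 2) := by
      rw [hs, div_pow, show Real.sqrt 2 ^ 3 = Real.sqrt 2 ^ 2 * Real.sqrt 2 by ring, hsq2]
    rw [hcube, div_div, div_le_div_iff_of_pos_left (pow_pos hr 3) (by norm_num) (by positivity)]
    have : Real.sqrt 2 ≤ 3 / 2 := by
      rw [show (3 / 2 : ℝ) = Real.sqrt ((3 / 2) ^ 2) by rw [Real.sqrt_sq (by norm_num)]]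
      exact Real.sqrt_le_sqrt (by norm_num)
    nlinarith
  rw [measureReal_def, ← ENNReal.ofReal_le_iff_le_toReal (measure_ne_top _ _)]
  exact ((ENNReal.ofReal_le_ofReal hs3).trans h).trans (measure_mono hsub)

/-! ### The one-plaquette Laplace bound -/

/-- **On the unit ball the trace deficit of the radial projection dominates `|im x|²`**: for `‖x‖ ≤ 1`,
`|im x|² ≤ 2 − Re tr(x/‖x‖)` (`2 − Re tr = 2(‖x‖ − re)/‖x‖ ≥ 2(‖x‖ − re) ≥ |im|²` since `‖x‖ + re ≤ 2`; at `x = 0` both sides vanish). [folklore] -/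
theorem im_sq_le_two_sub_trace_re_quatToSU2 {x : ℍ} (hx1 : ‖x‖ ≤ 1) :
    x.imI ^ 2 + x.imJ ^ 2 + x.imK ^ 2 ≤
      2 - (((quatToSU2 x : (Matrix.specialUnitaryGroup (Fin 2) ℂ)) : Matrix (Fin 2) (Fin 2) ℂ).trace).re := by
  by_cases hx : x = 0
  · subst hx
    have h0 : (((quatToSU2 (0 : ℍ) : (Matrix.specialUnitaryGroup (Fin 2) ℂ)) : Matrix (Fin 2) (Fin 2) ℂ).trace).re = 2 := by
      rw [quatToSU2, dif_pos rfl]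
      simp [Matrix.trace]
    rw [h0]
    simp
  rw [trace_quatToSU2_re hx]
  have hn : 0 < ‖x‖ := norm_pos_iff.2 hx
  have hre := abs_le.1 (abs_re_le_norm x)
  have hsq := sq_norm_eq_sum_sq x
  have him : x.imI ^ 2 + x.imJ ^ 2 + x.imK ^ 2 = (‖x‖ - x.re) * (‖x‖ + x.re) := by nlinarith
  have h1 : 2 - 2 * (‖x‖⁻¹ * x.re) = 2 * (‖x‖ - x.re) / ‖x‖ := by field_simp
  rw [h1, him, le_div_iff₀ hn]
  have h2 : 0 ≤ ‖x‖ - x.re := by linarith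
  have h3 : ‖x‖ + x.re ≤ 2 := by linarith
  calc (‖x‖ - x.re) * (‖x‖ + x.re) * ‖x‖ ≤ (‖x‖ - x.re) * 2 * 1 := by
        rw [mul_assoc, mul_assoc]
        exact mul_le_mul_of_nonneg_left (mul_le_mul h3 hx1 hn.le (by norm_num)) h2
    _ = 2 * (‖x‖ - x.re) := by ring

/-- The Gaussian integral over `ℝ³` (product Lebesgue measure on `Fin 3 → ℝ`): `∫ exp(−b Σ v_i²) dv = (π/b)^{3/2}` for `b > 0`. [folklore] -/
theorem integral_exp_neg_mul_sum_sq_fin_three (b : ℝ) :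
    ∫ v : Fin 3 → ℝ, Real.exp (-b * ∑ i, v i ^ 2) = Real.sqrt (Real.pi / b) ^ 3 := by
  have h : (fun v : Fin 3 → ℝ => Real.exp (-b * ∑ i, v i ^ 2)) = fun v => ∏ i, Real.exp (-b * v i ^ 2) := by
    funext v
    rw [← Real.exp_sum, Finset.mul_sum]
  rw [h, integral_fintype_prod_volume_eq_pow (fun t : ℝ => Real.exp (-b * t ^ 2)), integral_gaussian, Fintype.card_fin]

/-- **THE ONE-PLAQUETTE LAPLACE BOUND for `SU(2)`**: for `b > 0`, `∫ exp(−b(2 − Re tr U)) dHaar(U) ≤ 3/(b√b)` (`= O(b^{−dim SU(2)/2})`): by the cone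
description of Haar measure and `2 − Re tr(x/‖x‖) ≥ |im x|²` on the unit ball, the integral is at most `(2/π²)·∫_{|re|<1}∫_{ℝ³} e^{−b|v|²} dv dt
= 4 π^{−1/2} b^{−3/2} ≤ 3 b^{−3/2}`. [folklore] -/
theorem lintegral_exp_neg_mul_two_sub_trace_le {b : ℝ} (hb : 0 < b) :
    ∫⁻ U, ENNReal.ofReal (Real.exp (-(b * (2 - ((U : Matrix (Fin 2) (Fin 2) ℂ).trace).re))))
        ∂(haarProbability (Matrix.specialUnitaryGroup (Fin 2) ℂ)) ≤
      ENNReal.ofReal (3 / (b * Real.sqrt b)) := by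
  letI : MeasurableSpace ℍ := Literature.Analysis.FluidPDE.Tao2016.quatMeasurableSpace
  haveI : BorelSpace ℍ := Literature.Analysis.FluidPDE.Tao2016.quatBorelSpace
  set F : Matrix.specialUnitaryGroup (Fin 2) ℂ → ℝ≥0∞ :=
    fun U => ENNReal.ofReal (Real.exp (-(b * (2 - ((U : Matrix (Fin 2) (Fin 2) ℂ).trace).re)))) with hF
  have hcont : Continuous fun U : Matrix.specialUnitaryGroup (Fin 2) ℂ => 2 - ((U : Matrix (Fin 2) (Fin 2) ℂ).trace).re :=
    continuous_const.sub (Complex.continuous_re.comp (continuous_subtype_val.matrix_trace))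
  have hFm : Measurable F := ENNReal.measurable_ofReal.comp (Real.measurable_exp.comp (hcont.measurable.const_mul b).neg)
  rw [lintegral_haarProbability_su2 F hFm]
  -- the Gaussian majorant in the coordinates `ℍ ≃ ℝ × ℝ³`
  set Gc : ℝ × (Fin 3 → ℝ) → ℝ≥0∞ := fun p => (Set.Ioo (-1 : ℝ) 1).indicator 1 p.1 * ENNReal.ofReal (Real.exp (-b * ∑ i, p.2 i ^ 2))
    with hGc
  have hGcm : Measurable Gc := by
    refine Measurable.mul ((measurable_one.indicator measurableSet_Ioo).comp measurable_fst) ?_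
    refine ENNReal.measurable_ofReal.comp (Real.measurable_exp.comp (Measurable.const_mul ?_ _))
    exact (Finset.measurable_sum _ fun i _ => (measurable_pi_apply i).pow_const 2).comp measurable_snd
  -- pointwise on the ball: `F(P x) ≤ Gc(re x, im x)`
  have hpt : ∀ x : ℍ, x ∈ Metric.ball (0 : ℍ) 1 → F (quatToSU2 x) ≤ Gc (quatReImEquiv x) := by
    intro x hx
    rw [Metric.mem_ball, dist_zero_right] at hx
    rw [quatReImEquiv_apply, hGc]
    have hre := abs_lt.1 (lt_of_le_of_lt (abs_re_le_norm x) hx)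
    simp only [Set.indicator_of_mem (show x.re ∈ Set.Ioo (-1 : ℝ) 1 from ⟨hre.1, hre.2⟩), Pi.one_apply, one_mul]
    refine ENNReal.ofReal_le_ofReal (Real.exp_le_exp.2 ?_)
    have hsum : ∑ i : Fin 3, (![x.imI, x.imJ, x.imK] : Fin 3 → ℝ) i ^ 2 = x.imI ^ 2 + x.imJ ^ 2 + x.imK ^ 2 := by
      simp [Fin.sum_univ_three]
    rw [hsum]
    have h := im_sq_le_two_sub_trace_re_quatToSU2 hx.le
    nlinarith
  -- integrate: `∫_B F∘P ≤ ∫ Gc ∘ quatReImEquiv = ∫ Gc = 2 · (π/b)^{3/2}`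
  have hI1 : ∫⁻ x in Metric.ball (0 : ℍ) 1, F (quatToSU2 x) ≤ ∫⁻ x, Gc (quatReImEquiv x) := by
    calc ∫⁻ x in Metric.ball (0 : ℍ) 1, F (quatToSU2 x) ≤ ∫⁻ x in Metric.ball (0 : ℍ) 1, Gc (quatReImEquiv x) :=
          setLIntegral_mono (hGcm.comp quatReImEquiv.measurable) hpt
      _ ≤ ∫⁻ x, Gc (quatReImEquiv x) := setLIntegral_le_lintegral _ _
  have hI2 : ∫⁻ x, Gc (quatReImEquiv x) = ∫⁻ p, Gc p := (measurePreserving_quatReImEquiv.lintegral_comp hGcm)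
  have hint3 : Integrable (fun v : Fin 3 → ℝ => Real.exp (-b * ∑ i, v i ^ 2)) := by
    have h : (fun v : Fin 3 → ℝ => Real.exp (-b * ∑ i, v i ^ 2)) = fun v => ∏ i, Real.exp (-b * v i ^ 2) := by
      funext v; rw [← Real.exp_sum, Finset.mul_sum]
    rw [h]
    exact Integrable.fintype_prod (fun _ => integrable_exp_neg_mul_sq hb)
  have hgm : Measurable fun v : Fin 3 → ℝ => ENNReal.ofReal (Real.exp (-b * ∑ i, v i ^ 2)) :=
    ENNReal.measurable_ofReal.comp (Real.measurable_exp.comp (Measurable.const_mul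
      (Finset.measurable_sum _ fun i _ => (measurable_pi_apply i).pow_const 2) _))
  have hI3 : ∫⁻ p, Gc p = ENNReal.ofReal 2 * ENNReal.ofReal (Real.sqrt (Real.pi / b) ^ 3) := by
    have hGc' : Gc = fun p : ℝ × (Fin 3 → ℝ) => (fun t : ℝ => (Set.Ioo (-1 : ℝ) 1).indicator (1 : ℝ → ℝ≥0∞) t) p.1 *
        (fun v : Fin 3 → ℝ => ENNReal.ofReal (Real.exp (-b * ∑ i, v i ^ 2))) p.2 := by
      rw [hGc]
    rw [hGc', Measure.volume_eq_prod, lintegral_prod_mul ((measurable_one.indicator measurableSet_Ioo).aemeasurable)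
      hgm.aemeasurable]
    congr 1
    · rw [lintegral_indicator_one measurableSet_Ioo, Real.volume_Ioo]; norm_num
    · rw [← integral_exp_neg_mul_sum_sq_fin_three b,
        ofReal_integral_eq_lintegral_ofReal hint3 (ae_of_all _ fun v => (Real.exp_pos _).le)]
  rw [volume_ball_quat]
  calc (ENNReal.ofReal (Real.pi ^ 2 / 2))⁻¹ * ∫⁻ x in Metric.ball (0 : ℍ) 1, F (quatToSU2 x)
      ≤ (ENNReal.ofReal (Real.pi ^ 2 / 2))⁻¹ * (ENNReal.ofReal 2 * ENNReal.ofReal (Real.sqrt (Real.pi / b) ^ 3)) := by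
        rw [← hI3, ← hI2]; exact mul_le_mul_right hI1 _
    _ = ENNReal.ofReal (2 * Real.sqrt (Real.pi / b) ^ 3 / (Real.pi ^ 2 / 2)) := by
        rw [show ENNReal.ofReal (2 * Real.sqrt (Real.pi / b) ^ 3 / (Real.pi ^ 2 / 2)) =
              ENNReal.ofReal (2 * Real.sqrt (Real.pi / b) ^ 3) / ENNReal.ofReal (Real.pi ^ 2 / 2) from
            ENNReal.ofReal_div_of_pos (by positivity),
          ENNReal.div_eq_inv_mul, ENNReal.ofReal_mul (by norm_num : (0:ℝ) ≤ 2)]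
    _ ≤ ENNReal.ofReal (3 / (b * Real.sqrt b)) := by
        refine ENNReal.ofReal_le_ofReal ?_
        -- `2 (π/b)^{3/2} · 2/π² = 4 π^{-1/2} b^{-3/2} ≤ 3 b^{-3/2}` since `16 ≤ 9π`
        have hπ : 3 < Real.pi := Real.pi_gt_three
        have hπ0 : 0 < Real.pi := Real.pi_pos
        have hsb : 0 < Real.sqrt b := Real.sqrt_pos.2 hb
        have hsπ : 0 < Real.sqrt Real.pi := Real.sqrt_pos.2 hπ0
        have hsqrt : Real.sqrt (Real.pi / b) = Real.sqrt Real.pi / Real.sqrt b := Real.sqrt_div' _ hb.le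
        have hsπ2 : Real.sqrt Real.pi ^ 2 = Real.pi := Real.sq_sqrt hπ0.le
        have hsb2 : Real.sqrt b ^ 2 = b := Real.sq_sqrt hb.le
        rw [hsqrt, div_pow, div_le_div_iff₀ (by positivity) (by positivity)]
        have e1 : Real.sqrt Real.pi ^ 3 = Real.pi * Real.sqrt Real.pi := by rw [pow_succ, hsπ2]
        have e2 : Real.sqrt b ^ 3 = b * Real.sqrt b := by rw [pow_succ, hsb2]
        rw [e1, e2]
        have e3 : 2 * (Real.pi * Real.sqrt Real.pi / (b * Real.sqrt b)) * (b * Real.sqrt b) = 2 * (Real.pi * Real.sqrt Real.pi) := by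
          field_simp
        rw [e3]
        have h16 : Real.sqrt Real.pi ≤ 3 * Real.pi / 4 := by
          -- `√π ≤ 3π/4 ⟸ π ≤ 9π²/16 ⟸ 16 ≤ 9π`
          rw [Real.sqrt_le_left (by positivity)]
          nlinarith
        nlinarith

/-- **The one-plaquette Laplace bound, translated and inverted**: for `b > 0` and all `a, c ∈ SU(2)`,
`∫ exp(−b(2 − Re tr(a V⁻¹ c))) dHaar(V) ≤ 3/(b√b)` (two-sided translation and inversion invariance of Haar measure on a compact group).  This is the
one-link integral met when the link `V` of a plaquette with holonomy `a V⁻¹ c` is integrated out. [folklore] -/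
theorem lintegral_exp_neg_mul_two_sub_trace_conj_inv_le {b : ℝ} (hb : 0 < b) (a c : Matrix.specialUnitaryGroup (Fin 2) ℂ) :
    ∫⁻ V, ENNReal.ofReal (Real.exp (-(b * (2 - (((a * V⁻¹ * c : Matrix.specialUnitaryGroup (Fin 2) ℂ) :
        Matrix (Fin 2) (Fin 2) ℂ).trace).re)))) ∂(haarProbability (Matrix.specialUnitaryGroup (Fin 2) ℂ)) ≤
      ENNReal.ofReal (3 / (b * Real.sqrt b)) := by
  set φ : Matrix.specialUnitaryGroup (Fin 2) ℂ → ℝ≥0∞ :=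
    fun U => ENNReal.ofReal (Real.exp (-(b * (2 - ((U : Matrix (Fin 2) (Fin 2) ℂ).trace).re)))) with hφ
  have h1 : ∫⁻ V, φ (a * V⁻¹ * c) ∂(haarProbability (Matrix.specialUnitaryGroup (Fin 2) ℂ)) =
      ∫⁻ V, φ V ∂(haarProbability (Matrix.specialUnitaryGroup (Fin 2) ℂ)) := by
    have hinv := lintegral_inv_eq_self (μ := haarProbability (Matrix.specialUnitaryGroup (Fin 2) ℂ))
      (fun V => φ (a * V * c))
    rw [hinv]
    have hl := lintegral_mul_left_eq_self (μ := haarProbability (Matrix.specialUnitaryGroup (Fin 2) ℂ))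
      (fun V => φ (V * c)) a
    rw [hl]
    exact lintegral_mul_right_eq_self φ c
  exact (le_of_eq h1).trans (lintegral_exp_neg_mul_two_sub_trace_le hb)

end Summit.QuantumFields.YangMills.Cruxes.UVSeamRec.ClassicalResponse.ThermalFloor

end
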